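import Summits.QuantumFields.YangMills.Theorems.LangevinControlUVOSLegsFromFemtoAndGapDefsR3
import Summits.QuantumFields.YangMills.Theorems.LangevinControlUVOSLegsFromFemtoAndGapStubAssemblyRPLimit
import Summits.QuantumFields.YangMills.Theorems.PencilRigidityNPointIsotropyUnorderedRPTransport
import Literature.MathematicalPhysics.QuantumFieldTheory.SpeciesLatticeProducts
import Literature.MathematicalPhysics.QuantumLattice.ReflectedCorrelationPolarisation
import HarnessLib

/-!
# Stub `stub_rope` of line `Sketch` (crux `OSLegsAtWeakCouplingC`, stmt-QuantumFields-16207) — helpers IV: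
# the lattice reflected autocorrelation along a soft bundle and its limit

Helper file for stub `stub_rope` (DefsR3 §4.4).  For a positive-time off-diagonal test function `F` with time support in
`(0, T]`, the smeared lattice field `X = fieldObs r L a F m` (toolkit XVII, `m` = the torus plane means) has the
reflected, time-shifted connected autocorrelation `osCorr(μ, Θ, τ_M)(X, X) = E[conj X(ΘU) · X(τ_M U)] − |E X|²`.
* §1 bookkeeping: the torus time shift moves the sites of a plane string (`strObs_torusTimeShift`), hence
  `X_F ∘ τ_M = X_{T_{aM e₀} F}` while the shifted time support stays in the box (`fieldObs_torusTimeShift`);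
  `E[X_F] = latticeDist n F` (`integral_fieldObs`); the reflected pair expectation expands into plane-string weights at
  the reflected sites (`integral_conj_fieldObs_mul_fieldObs`, the two-function form of toolkit XVIII).
* §2 `norm_osCorr_sub_latticeConn_le` (registered): at fixed `(β, L, a)`,
  `‖osCorr(τ_M)(X, X) − (latticeDist (n+n) (ΘF* ⊗ T_{aM e₀}F) − conj(latticeDist n F) · latticeDist n F)‖ = O(a)`,
  by the reindexing of toolkit XIX (`rpTerm_eq_shifted`) and the defect bound of toolkit XX (`norm_rpDefect_le`) fed
  with the shift-defect bound of the bundle; `ΘF* ⊗ T_sF ∈ ⁰𝒮` for `s ≥ 0` by `isOffDiagonal_osAdjoint_appendTensor`.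
* §3 `tendsto_osCorr_softBundle` (registered): along a soft bundle, with `a_k m_k → t` and the shifted support inside
  the torus, `osCorr_k(τ_{m_k})(X_k, X_k) → S₁(ΘF* ⊗ T_tF) − conj(S₁ F) · S₁ F`: the `O(a_k)` estimate of §2, the
  bundle's convergence of the centred density distributions on `⁰𝒮` (arity `n + n ≥ 2`; arity `1` is identically
  zero on both sides), its a-uniform bound (equicontinuity on `⁰𝒮`) and `T_{a_k m_k e₀}F → T_{t e₀}F` in `𝓢`.
Refs: OsterwalderSeiler1978 §2; GlimmJaffe1987 §6.1; OsterwalderSchrader1973 §2.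
-/

set_option autoImplicit false

noncomputable section

open scoped SchwartzMap BigOperators ComplexConjugate
open MeasureTheory Filter Topology
open Literature.MathematicalPhysics.QuantumFieldTheory Literature.MathematicalPhysics.QuantumLattice
open Literature.MathematicalPhysics.AQFT
open Literature.Probability.LatticeModels (box Site mem_box)
open Summit.QuantumFields.YangMills.Cruxes.OSLegsFromFemtoAndGap.DlrCollarTransfer
open Summit.QuantumFields.YangMills.Theorems.OSLegsFromFemtoAndGap
open Summit.QuantumFields.YangMills.Theorems.NPointIsotropy.QuarterTurnCornerOperator.UnorderedRP
  (isOffDiagonal_osAdjoint_appendTensor)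

namespace Summit.QuantumFields.YangMills.Theorems.OSLegsAtWeakCouplingC

local notation "E4" => EuclideanSpace ℝ (Fin 4)

variable {G : Type} [Group G] [TopologicalSpace G] [IsTopologicalGroup G] [CompactSpace G]
  [MeasurableSpace G] [BorelSpace G]

/-! ## §1 Bookkeeping: time shifts of strings and fields, the mean, the reflected pair expectation -/

/-- `a · (M e₀) = (a M) e₀` in physical units. -/
theorem smul_siteToE_single (a : ℝ) (M : ℕ) :
    a • siteToE (Pi.single (0 : Fin 4) (M : ℤ)) = EuclideanSpace.single (0 : Fin 4) (a * M) := by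
  ext k
  rw [PiLp.smul_apply, siteToE_apply, smul_eq_mul]
  by_cases hk : k = 0
  · subst hk; simp
  · simp [hk]

/-- From the support condition `⌈T/a⌉₊ + 2 + M ≤ L + 1`: the three inequalities of §2 with `w = ⌈T/a⌉₊ + 1`. -/
theorem rope_support_bounds {a T : ℝ} (ha : 0 < a) {L M : ℕ} (h : ⌈T / a⌉₊ + 2 + M ≤ L + 1) :
    T < a * L ∧ T < a * ((⌈T / a⌉₊ + 1 : ℕ) : ℝ) ∧ ⌈T / a⌉₊ + 1 + M ≤ L + 1 := by
  have h1 : T < a * ((⌈T / a⌉₊ + 1 : ℕ) : ℝ) := by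
    rw [mul_comm, ← div_lt_iff₀ ha]; push_cast; linarith [Nat.le_ceil (T / a)]
  exact ⟨h1.trans_le (mul_le_mul_of_nonneg_left (by exact_mod_cast (by omega : ⌈T / a⌉₊ + 1 ≤ L)) ha.le), h1, by omega⟩

omit [IsTopologicalGroup G] [CompactSpace G] [BorelSpace G] in
/-- **The torus time shift moves the sites of a string**: `strObs q m y (τ_M U) = strObs q m (y + M e₀) U`. -/
theorem strObs_torusTimeShift (r : LatticeRep G) (L M : ℕ) {n : ℕ} (q : Fin n → Fin 4 × Fin 4) (m : Fin n → ℝ)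
    (y : Fin n → Site 4) (U : GaugeConfig 4 (2 * L + 1) G) :
    strObs r L q m y (torusTimeShift (2 * L + 1) M U) = strObs r L q m (fun l => y l + Pi.single (0 : Fin 4) (M : ℤ)) U := by
  unfold strObs plane
  refine Finset.prod_congr rfl fun l _ => ?_
  rw [torusLift_torusTimeShift, configShift_neg_add]

/-- Sites carrying a test function with time support in `(0, T]`, `T < a w`, have `1 ≤ y_l⁰ ≤ w − 1`. -/
theorem time_bounds_of_apply_ne_zero {n : ℕ} {a T : ℝ} (ha : 0 < a) {w : ℕ} (hTw : T < a * w) (F : 𝓢((Fin n → E4), ℂ))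
    (hFT : ∀ u : Fin n → E4, (∃ l, u l 0 ≤ 0 ∨ T < u l 0) → F u = 0) {y : Fin n → Site 4}
    (hy : F (fun l => a • siteToE (y l)) ≠ 0) (l : Fin n) : 1 ≤ y l 0 ∧ y l 0 + 1 ≤ w := by
  by_contra h
  refine hy (apply_eq_zero_of_time ha F hFT y ⟨l, ?_⟩)
  rcases not_and_or.1 h with h | h
  · exact Or.inl (by omega)
  · refine Or.inr (hTw.trans_le (mul_le_mul_of_nonneg_left ?_ ha.le))
    exact_mod_cast (show (w : ℤ) ≤ y l 0 by omega)

omit [IsTopologicalGroup G] [CompactSpace G] [BorelSpace G] in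
/-- **The time shift of the smeared field is the smeared field of the translated test function**,
`X_F(τ_M U) = X_{T_{aM e₀}F}(U)`, as long as the shifted time support stays in the box (`T < a w`, `w + M ≤ L + 1`). -/
theorem fieldObs_torusTimeShift (r : LatticeRep G) {L : ℕ} {a T : ℝ} (ha : 0 < a) {n : ℕ} (F : 𝓢((Fin n → E4), ℂ))
    (hFT : ∀ u : Fin n → E4, (∃ l, u l 0 ≤ 0 ∨ T < u l 0) → F u = 0) {w M : ℕ} (hTw : T < a * w)
    (hML : w + M ≤ L + 1) (m : Fin 4 × Fin 4 → ℝ) (U : GaugeConfig 4 (2 * L + 1) G) :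
    fieldObs r L a F m (torusTimeShift (2 * L + 1) M U) =
      fieldObs r L a (translateMulti (a • siteToE (Pi.single (0 : Fin 4) (M : ℤ))) F) m U := by
  classical
  unfold fieldObs
  refine Finset.sum_congr rfl fun q _ => ?_
  simp_rw [strObs_torusTimeShift]
  set e : Site 4 := Pi.single (0 : Fin 4) (M : ℤ) with he
  have hT : ∀ y : Fin n → Site 4, translateMulti (a • siteToE e) F (fun l => a • siteToE (y l)) =
      F (fun l => a • siteToE (y l - e)) := fun y => by
    rw [translateMulti_apply]; congr 1; funext l; rw [siteToE_sub, smul_sub]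
  simp_rw [hT]
  have he0 : e 0 = M := by simp [he]
  have hek : ∀ k : Fin 4, k ≠ 0 → e k = 0 := fun k hk => by simp [he, hk]
  -- on the non-vanishing terms, `y ↦ y + e` is a bijection of the box
  have key : ∀ y : Fin n → Site 4, F (fun l => a • siteToE (y l)) ≠ 0 →
      (y ∈ Fintype.piFinset (fun _ : Fin n => box 4 L) ↔
        (fun l => y l + e) ∈ Fintype.piFinset (fun _ : Fin n => box 4 L)) := by
    intro y hy
    have hb := time_bounds_of_apply_ne_zero ha hTw F hFT hy
    simp only [Fintype.mem_piFinset, mem_box, Pi.add_apply]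
    refine forall_congr' fun l => forall_congr' fun k => ?_
    by_cases hk : k = 0
    · subst hk; rw [he0]; have := hb l; constructor <;> rintro ⟨_, _⟩ <;> exact ⟨by omega, by omega⟩
    · rw [hek k hk, add_zero]
  rw [← Finset.sum_filter_ne_zero (s := Fintype.piFinset fun _ : Fin n => box 4 L),
    ← Finset.sum_filter_ne_zero (s := Fintype.piFinset fun _ : Fin n => box 4 L)
      (f := fun y => F (fun l => a • siteToE (y l - e)) * (strObs r L q (fun l => m (q l)) y U : ℂ))]
  refine Finset.sum_bij' (fun y _ => fun l => y l + e) (fun y _ => fun l => y l - e) (fun y hy => ?_) (fun y hy => ?_)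
    (fun y _ => funext fun l => add_sub_cancel_right _ _) (fun y _ => funext fun l => sub_add_cancel _ _)
    (fun y _ => by simp only [add_sub_cancel_right])
  · rw [Finset.mem_filter] at hy ⊢
    have hF0 : F (fun l => a • siteToE (y l)) ≠ 0 := fun h => hy.2 (by rw [h, zero_mul])
    exact ⟨(key y hF0).1 hy.1, by simp only [add_sub_cancel_right]; exact hy.2⟩
  · rw [Finset.mem_filter] at hy ⊢
    have hF0 : F (fun l => a • siteToE (y l - e)) ≠ 0 := fun h => hy.2 (by rw [h, zero_mul])
    have h2 := (key (fun l => y l - e) hF0).2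
    simp only [sub_add_cancel] at h2 ⊢
    exact ⟨h2 hy.1, hy.2⟩

/-- **The mean of the smeared field is the centred density distribution**: `E[X_F] = latticeDist n F`. -/
theorem integral_fieldObs (r : LatticeRep G) (β : ℝ) (L : ℕ) (a : ℝ) {n : ℕ} (F : 𝓢((Fin n → E4), ℂ)) :
    ∫ U, fieldObs r L a F (fun pl => wilsonTorusMean r.ρ β L (fun U => plaquetteObs r.ρ 0 pl.1 pl.2 U)) U
        ∂(wilsonMeasure (d := 4) (L := 2 * L + 1) r.ρ β) =
      latticeDist r.ρ β L a r.curvature.F (wilsonTorusMean r.ρ β L r.curvature.F) n F := by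
  rw [latticeDist_dens_eq_sum_latticeDistStr]
  unfold fieldObs
  rw [integral_finsetSum _ fun q _ => integrable_finsetSum _ fun y _ => (integrable_strObs r β L q _ y).ofReal.const_mul _]
  refine Finset.sum_congr rfl fun q _ => ?_
  rw [latticeDistStr_apply, integral_finsetSum _ fun y _ => (integrable_strObs r β L q _ y).ofReal.const_mul _]
  refine Finset.sum_congr rfl fun y _ => ?_
  rw [integral_const_mul, integral_complex_ofReal, integral_strObs, mul_comm]

/-- **The reflected pair expectation in plane-string weights** (toolkit XVIII `wilsonExpectation_rpSquare_eq` for one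
pair of test functions): `E[conj X_{Fi}(ΘU) · X_{Fj}(U)] = Σ_{q,p} Σ_{x,y} conj Fi(a x) Fj(a y) W^{q ++ p}(θ̃x ++ y)`. -/
theorem integral_conj_fieldObs_mul_fieldObs (r : LatticeRep G) (β : ℝ) (L : ℕ) (a : ℝ) {n k : ℕ}
    (Fi : 𝓢((Fin n → E4), ℂ)) (Fj : 𝓢((Fin k → E4), ℂ)) (m : Fin 4 × Fin 4 → ℝ) :
    ∫ U, conj (fieldObs r L a Fi m (GaugeConfig.timeReflect U)) * fieldObs r L a Fj m U
        ∂(wilsonMeasure (d := 4) (L := 2 * L + 1) r.ρ β) =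
      ∑ q ∈ Fintype.piFinset (fun _ : Fin n => Finset.univ.filter fun pl : Fin 4 × Fin 4 => pl.1 < pl.2),
        ∑ p ∈ Fintype.piFinset (fun _ : Fin k => Finset.univ.filter fun pl : Fin 4 × Fin 4 => pl.1 < pl.2),
        ∑ x ∈ Fintype.piFinset (fun _ : Fin n => box 4 L), ∑ y ∈ Fintype.piFinset (fun _ : Fin k => box 4 L),
          conj (Fi (fun l => a • siteToE (x l))) * Fj (fun l => a • siteToE (y l)) *
            (torusMomentStr r.ρ β L (fun l U => plaquetteObs r.ρ 0 (Fin.append q p l).1 (Fin.append q p l).2 U)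
              (Fin.append (fun l => m (q l)) (fun l => m (p l))) (Fin.append (fun l => thetaSite (q l) (x l)) y) : ℂ) := by
  -- adapted from toolkit XVIII `wilsonExpectation_rpSquare_eq`
  classical
  have hI : ∀ (q : Fin n → Fin 4 × Fin 4) (p : Fin k → Fin 4 × Fin 4) (x : Fin n → Site 4) (y : Fin k → Site 4),
      Integrable (fun U : GaugeConfig 4 (2 * L + 1) G =>
      conj (Fi (fun l => a • siteToE (x l))) * Fj (fun l => a • siteToE (y l)) *
        ((strObs r L q (fun l => m (q l)) (fun l => thetaSite (q l) (x l)) U * strObs r L p (fun l => m (p l)) y U : ℝ) : ℂ))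
      (wilsonMeasure (d := 4) (L := 2 * L + 1) r.ρ β) := fun q p x y => integrable_rpTerm r β L _ q p _ _ _ _
  have hpt : ∀ U : GaugeConfig 4 (2 * L + 1) G, conj (fieldObs r L a Fi m U.timeReflect) * fieldObs r L a Fj m U =
      ∑ q ∈ Fintype.piFinset (fun _ : Fin n => Finset.univ.filter fun pl : Fin 4 × Fin 4 => pl.1 < pl.2),
        ∑ p ∈ Fintype.piFinset (fun _ : Fin k => Finset.univ.filter fun pl : Fin 4 × Fin 4 => pl.1 < pl.2),
        ∑ x ∈ Fintype.piFinset (fun _ : Fin n => box 4 L), ∑ y ∈ Fintype.piFinset (fun _ : Fin k => box 4 L),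
          conj (Fi (fun l => a • siteToE (x l))) * Fj (fun l => a • siteToE (y l)) *
            ((strObs r L q (fun l => m (q l)) (fun l => thetaSite (q l) (x l)) U * strObs r L p (fun l => m (p l)) y U : ℝ) : ℂ) := by
    intro U
    unfold fieldObs
    simp only [map_sum]
    rw [Finset.sum_mul]
    refine Finset.sum_congr rfl fun q hq => ?_
    rw [Finset.mul_sum]
    refine Finset.sum_congr rfl fun p _ => ?_
    rw [Finset.sum_mul]
    refine Finset.sum_congr rfl fun x _ => ?_
    rw [Finset.mul_sum]
    refine Finset.sum_congr rfl fun y _ => ?_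
    rw [map_mul, Complex.conj_ofReal, strObs_timeReflect r L ((mem_planeStrings_iff'' q).1 hq)]
    push_cast
    ring
  simp_rw [hpt]
  rw [integral_finsetSum _ fun q _ => integrable_finsetSum _ fun p _ => integrable_finsetSum _ fun x _ =>
    integrable_finsetSum _ fun y _ => hI q p x y]
  refine Finset.sum_congr rfl fun q _ => ?_
  rw [integral_finsetSum _ fun p _ => integrable_finsetSum _ fun x _ => integrable_finsetSum _ fun y _ => hI q p x y]
  refine Finset.sum_congr rfl fun p _ => ?_
  rw [integral_finsetSum _ fun x _ => integrable_finsetSum _ fun y _ => hI q p x y]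
  refine Finset.sum_congr rfl fun x _ => ?_
  rw [integral_finsetSum _ fun y _ => hI q p x y]
  refine Finset.sum_congr rfl fun y _ => ?_
  rw [integral_const_mul]
  congr 1
  simp_rw [strObs_mul_strObs]
  rw [integral_complex_ofReal, integral_strObs]

/-! ## §2 The fixed-lattice estimate -/

/-- **The reflected shifted autocorrelation versus the lattice connected OS form** (registered helper of `stub_rope`):
for `X = X_F` with `F` positive-time, off-diagonal, time support in `(0, T]`, `T < a L`, `T < a w`, `w + M ≤ L + 1`,
`‖osCorr(μ_{β,2L+1}, Θ, τ_M)(X, X) − (latticeDist (n+n) (ΘF* ⊗ T_{aM e₀}F) − conj(latticeDist n F) · latticeDist n F)‖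
 ≤ 6ⁿ 6ⁿ · 2 a K^{2n} Σ⁺(ΘF* ⊗ T_{aM e₀}F)` given the shift-defect bound `hdef` of the plane strings at `(β, L, a)`:
`E[X_F ∘ τ_M · conj X_F ∘ Θ] = E[conj X_F(Θ·) X_{T F}]` (§1) is the reindexed sum `P` of toolkit XIX, the lattice OS
form is `Z` of toolkit XX, `‖Z − P‖ = O(a)` (`norm_rpDefect_le`), and the means agree exactly (`integral_fieldObs`). -/
theorem norm_osCorr_sub_latticeConn_le : ∀ {G : Type} [Group G] [TopologicalSpace G] [IsTopologicalGroup G]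
    [CompactSpace G] [MeasurableSpace G] [BorelSpace G] (r : LatticeRep G) {β : ℝ} {L : ℕ} {a T K : ℝ} (ha : 0 < a)
    (hK : 0 ≤ K) (hTL : T < a * L) {n : ℕ} (F : 𝓢((Fin n → EuclideanSpace ℝ (Fin 4)), ℂ)) (hFp : IsPositiveTimeMulti
    F) (hFo : IsOffDiagonal F) (hFT : ∀ u : Fin n → EuclideanSpace ℝ (Fin 4), (∃ l, u l 0 ≤ 0 ∨ T < u l 0) → F u =
    0) {w M : ℕ} (hTw : T < a * w) (hML : w + M ≤ L + 1) (hdef : ∀ m : ℕ, 2 ≤ m → ∀ rr : Fin m → Fin 4 × Fin 4, (∀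
    i, (rr i).1 < (rr i).2) → ∀ F : 𝓢((Fin m → EuclideanSpace ℝ (Fin 4)), ℂ), IsOffDiagonal F → ∀ c : Fin m →
    EuclideanSpace ℝ (Fin 4), (∀ l, ‖c l‖ ≤ a) → ‖∑ z ∈ Fintype.piFinset (fun _ : Fin m => box 4 L),
    ((torusMomentStr r.ρ β L (fun i U => plaquetteObs r.ρ 0 (rr i).1 (rr i).2 U) (fun i => wilsonTorusMean r.ρ β L
    (fun U => plaquetteObs r.ρ 0 (rr i).1 (rr i).2 U)) z : ℝ) : ℂ) * (F ((fun l => a • siteToE (z l)) + c) - F (fun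
    l => a • siteToE (z l)))‖ ≤ 2 * ‖c‖ * K ^ m * (SchwartzMap.seminorm ℂ 0 (4 * m + 1) F + SchwartzMap.seminorm ℂ
    (6 * m) (4 * m + 1) F + SchwartzMap.seminorm ℂ 0 1 F + SchwartzMap.seminorm ℂ (6 * m) 1 F + SchwartzMap.seminorm
    ℂ (10 * m) 1 F)), ‖osCorr (wilsonMeasure (d := 4) (L := 2 * L + 1) r.ρ β) GaugeConfig.timeReflect
    (⇑(torusTimeShift (2 * L + 1) M)) (fieldObs r L a F (fun pl => wilsonTorusMean r.ρ β L (fun U => plaquetteObs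
    r.ρ 0 pl.1 pl.2 U))) (fieldObs r L a F (fun pl => wilsonTorusMean r.ρ β L (fun U => plaquetteObs r.ρ 0 pl.1 pl.2
    U))) - (latticeDist r.ρ β L a r.curvature.F (wilsonTorusMean r.ρ β L r.curvature.F) (n + n) ((osAdjoint
    F).appendTensor (translateMulti (a • siteToE (Pi.single (0 : Fin 4) (M : ℤ))) F)) - conj (latticeDist r.ρ β L a
    r.curvature.F (wilsonTorusMean r.ρ β L r.curvature.F) n F) * latticeDist r.ρ β L a r.curvature.F
    (wilsonTorusMean r.ρ β L r.curvature.F) n F)‖ ≤ 6 ^ n * 6 ^ n * (2 * a * K ^ (n + n) * (SchwartzMap.seminorm ℂ 0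
    (4 * (n + n) + 1) ((osAdjoint F).appendTensor (translateMulti (a • siteToE (Pi.single (0 : Fin 4) (M : ℤ))) F))
    + SchwartzMap.seminorm ℂ (6 * (n + n)) (4 * (n + n) + 1) ((osAdjoint F).appendTensor (translateMulti (a •
    siteToE (Pi.single (0 : Fin 4) (M : ℤ))) F)) + SchwartzMap.seminorm ℂ 0 1 ((osAdjoint F).appendTensor
    (translateMulti (a • siteToE (Pi.single (0 : Fin 4) (M : ℤ))) F)) + SchwartzMap.seminorm ℂ (6 * (n + n)) 1
    ((osAdjoint F).appendTensor (translateMulti (a • siteToE (Pi.single (0 : Fin 4) (M : ℤ))) F)) +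
    SchwartzMap.seminorm ℂ (10 * (n + n)) 1 ((osAdjoint F).appendTensor (translateMulti (a • siteToE (Pi.single (0 :
    Fin 4) (M : ℤ))) F)))) := by
  intro G _ _ _ _ _ _ r β L a T K ha hK hTL n F hFp hFo hFT w M hTw hML hdef
  classical
  -- the OS witness is off-diagonal
  have hpos : IsPositiveTimeMulti (translateMulti (a • siteToE (Pi.single (0 : Fin 4) (M : ℤ))) F) := by
    rw [smul_siteToE_single]
    exact SchwingerFamily.IsPositiveTimeMulti.translateMulti_timeVec hFp (by positivity)
  have hHoff : IsOffDiagonal ((osAdjoint F).appendTensor (translateMulti (a • siteToE (Pi.single (0 : Fin 4) (M : ℤ))) F)) :=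
    isOffDiagonal_osAdjoint_appendTensor hFp hFo hpos (hFo.translateMulti _)
  -- `‖Z − P‖ = O(a)` (toolkit XX), with `P` rewritten as the reflected shifted pair expectation (toolkit XIX, §1)
  have hZP := norm_rpDefect_le r β L ha.le hK F (translateMulti (a • siteToE (Pi.single (0 : Fin 4) (M : ℤ))) F)
    ((osAdjoint F).appendTensor (translateMulti (a • siteToE (Pi.single (0 : Fin 4) (M : ℤ))) F))
    (isAppendTensorOf_appendTensor _ _) (fun rr hrr c hc => by
      rcases Nat.eq_zero_or_pos n with hn | hn
      · subst hn
        haveI : IsEmpty (Fin (0 + 0)) := ⟨fun i => absurd i.2 (by omega)⟩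
        rw [Finset.sum_eq_zero fun z _ => by
          rw [Subsingleton.elim ((fun l => a • siteToE (z l)) + c) (fun l => a • siteToE (z l)), sub_self, mul_zero],
          norm_zero]
        positivity
      · exact hdef (n + n) (by omega) rr hrr _ hHoff c hc)
  rw [← rpTerm_eq_shifted r β L ha hTL F hFT _ (fun pl => wilsonTorusMean r.ρ β L (fun U => plaquetteObs r.ρ 0 pl.1 pl.2 U)),
    ← integral_conj_fieldObs_mul_fieldObs r β L a F _ (fun pl => wilsonTorusMean r.ρ β L (fun U => plaquetteObs r.ρ 0 pl.1 pl.2 U))] at hZP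
  -- assemble
  unfold osCorr
  simp_rw [fieldObs_torusTimeShift r ha F hFT hTw hML]
  rw [integral_fieldObs, show ∀ p z c : ℂ, p - c - (z - c) = -(z - p) from fun p z c => by ring, norm_neg]
  exact hZP

/-! ## §3 The limit along a soft bundle -/

/-- The seminorm budgets of the bundle's plane-string bounds are continuous on `𝓢`. -/
theorem continuous_seminorm_budget (N a b c d : ℕ) : Continuous fun H : 𝓢((Fin N → E4), ℂ) =>
    SchwartzMap.seminorm ℂ 0 a H + SchwartzMap.seminorm ℂ b a H + SchwartzMap.seminorm ℂ 0 c H +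
      SchwartzMap.seminorm ℂ b c H + SchwartzMap.seminorm ℂ d c H := by
  have hc : ∀ k l : ℕ, Continuous fun H : 𝓢((Fin N → E4), ℂ) => SchwartzMap.seminorm ℂ k l H := fun k l =>
    (schwartz_withSeminorms ℂ (Fin N → E4) ℂ).continuous_seminorm (k, l)
  exact ((((hc _ _).add (hc _ _)).add (hc _ _)).add (hc _ _)).add (hc _ _)

/-- **The limit of the lattice reflected autocorrelation along a soft bundle** (registered helper of `stub_rope`): for
`F` positive-time, off-diagonal, with time support in `(0, T]`, shifts `m_k` with `a_k m_k → t` and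
`⌈T/a_k⌉₊ + 2 + m_k ≤ L_k + 1` eventually,
`osCorr(μ_k, Θ, τ_{m_k})(X_k, X_k) → S₁(ΘF* ⊗ T_{t e₀}F) − conj(S₁ F) · S₁ F`. -/
theorem tendsto_osCorr_softBundle : ∀ {G : Type} [Group G] [TopologicalSpace G] [IsTopologicalGroup G] [CompactSpace
    G] [MeasurableSpace G] [BorelSpace G] {r : LatticeRep G} {a : ℝ → ℝ} (hapos : ∀ β, 0 < a β) (ha0 : Tendsto a
    atTop (𝓝 0)) {sch : SpeciesScheme (YMSpecies G)} {S₁ : SchwingerFamily (EuclideanSpace ℝ (Fin 4))} {Tq : (n : ℕ)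
    → (Fin n → Fin 4 × Fin 4) → (𝓢((Fin n → EuclideanSpace ℝ (Fin 4)), ℂ) →L[ℂ] ℂ)} {K : ℝ} {b₀ : ℝ} {g : ℝ → ℕ → ℕ}
    (hB : SoftBundle G r a sch S₁ Tq K b₀ g) {n : ℕ} (hn : 1 ≤ n) (F : 𝓢((Fin n → EuclideanSpace ℝ (Fin 4)), ℂ))
    (hFp : IsPositiveTimeMulti F) (hFo : IsOffDiagonal F) {T : ℝ} (hFT : ∀ u : Fin n → EuclideanSpace ℝ (Fin 4), (∃
    l, u l 0 ≤ 0 ∨ T < u l 0) → F u = 0) (m : ℕ → ℕ) {t : ℝ} (hmt : Tendsto (fun k => sch.a k * m k) atTop (𝓝 t))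
    (hmL : ∀ᶠ k in atTop, ⌈T / sch.a k⌉₊ + 2 + m k ≤ sch.L k + 1), Tendsto (fun k => osCorr (wilsonMeasure (d := 4)
    (L := 2 * sch.L k + 1) r.ρ (sch.β k)) GaugeConfig.timeReflect (⇑(torusTimeShift (2 * sch.L k + 1) (m k)))
    (fieldObs r (sch.L k) (sch.a k) F (fun pl => wilsonTorusMean r.ρ (sch.β k) (sch.L k) (fun U => plaquetteObs r.ρ
    0 pl.1 pl.2 U))) (fieldObs r (sch.L k) (sch.a k) F (fun pl => wilsonTorusMean r.ρ (sch.β k) (sch.L k) (fun U =>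
    plaquetteObs r.ρ 0 pl.1 pl.2 U)))) atTop (𝓝 (S₁ (n + n) ((osAdjoint F).appendTensor (translateMulti
    (EuclideanSpace.single 0 t) F)) - conj (S₁ n F) * S₁ n F)) := by
  intro G _ _ _ _ _ _ r a _ _ sch S₁ Tq K b₀ g hB n hn F hFp hFo T hFT m t hmt hmL
  classical
  obtain ⟨⟨-, -, -, -, -, -, -, -, -, h10, h11, h12, -, -, -, -, -, h18, h19, -, -⟩, -⟩ := hB
  -- the moving OS witnesses `H_k = ΘF* ⊗ T_{a_k m_k e₀} F → H = ΘF* ⊗ T_{t e₀} F` in `𝓢`, all off-diagonal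
  have ht0 : 0 ≤ t := ge_of_tendsto' hmt fun k => mul_nonneg (sch.a_pos k).le (Nat.cast_nonneg _)
  have hHoff : IsOffDiagonal ((osAdjoint F).appendTensor (translateMulti (EuclideanSpace.single 0 t) F)) :=
    isOffDiagonal_osAdjoint_appendTensor hFp hFo (SchwingerFamily.IsPositiveTimeMulti.translateMulti_timeVec hFp ht0)
      (hFo.translateMulti _)
  have hHkoff : ∀ k, IsOffDiagonal ((osAdjoint F).appendTensor
      (translateMulti (sch.a k • siteToE (Pi.single (0 : Fin 4) (m k : ℤ))) F)) := fun k => by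
    refine isOffDiagonal_osAdjoint_appendTensor hFp hFo ?_ (hFo.translateMulti _)
    rw [smul_siteToE_single]
    exact SchwingerFamily.IsPositiveTimeMulti.translateMulti_timeVec hFp (mul_nonneg (sch.a_pos k).le (Nat.cast_nonneg _))
  have hHk : Tendsto (fun k => (osAdjoint F).appendTensor (translateMulti (sch.a k • siteToE (Pi.single (0 : Fin 4) (m k : ℤ))) F))
      atTop (𝓝 ((osAdjoint F).appendTensor (translateMulti (EuclideanSpace.single 0 t) F))) := by
    refine SchwartzMap.tendsto_appendTensor tendsto_const_nhds (((continuous_translateMulti F).tendsto _).comp ?_)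
    simp_rw [smul_siteToE_single]
    have he : ∀ s : ℝ, EuclideanSpace.single (0 : Fin 4) s = s • EuclideanSpace.single (0 : Fin 4) (1 : ℝ) := fun s => by
      ext j; by_cases hj : j = 0 <;> simp [hj]
    simp_rw [he (sch.a _ * _), he t]
    exact hmt.smul_const _
  -- (a) the fixed-lattice estimate, eventually
  have hnear : ∀ᶠ k in atTop, ‖osCorr (wilsonMeasure (d := 4) (L := 2 * sch.L k + 1) r.ρ (sch.β k)) GaugeConfig.timeReflect
      (⇑(torusTimeShift (2 * sch.L k + 1) (m k)))
      (fieldObs r (sch.L k) (sch.a k) F (fun pl => wilsonTorusMean r.ρ (sch.β k) (sch.L k) (fun U => plaquetteObs r.ρ 0 pl.1 pl.2 U)))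
      (fieldObs r (sch.L k) (sch.a k) F (fun pl => wilsonTorusMean r.ρ (sch.β k) (sch.L k) (fun U => plaquetteObs r.ρ 0 pl.1 pl.2 U))) -
      (latticeDist r.ρ (sch.β k) (sch.L k) (sch.a k) r.curvature.F (wilsonTorusMean r.ρ (sch.β k) (sch.L k) r.curvature.F) (n + n)
        ((osAdjoint F).appendTensor (translateMulti (sch.a k • siteToE (Pi.single (0 : Fin 4) (m k : ℤ))) F)) -
       conj (latticeDist r.ρ (sch.β k) (sch.L k) (sch.a k) r.curvature.F (wilsonTorusMean r.ρ (sch.β k) (sch.L k) r.curvature.F) n F) *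
        latticeDist r.ρ (sch.β k) (sch.L k) (sch.a k) r.curvature.F (wilsonTorusMean r.ρ (sch.β k) (sch.L k) r.curvature.F) n F)‖ ≤
      6 ^ n * 6 ^ n * (2 * sch.a k * K ^ (n + n) *
        (fun H : 𝓢((Fin (n + n) → E4), ℂ) => SchwartzMap.seminorm ℂ 0 (4 * (n + n) + 1) H +
          SchwartzMap.seminorm ℂ (6 * (n + n)) (4 * (n + n) + 1) H + SchwartzMap.seminorm ℂ 0 1 H +
          SchwartzMap.seminorm ℂ (6 * (n + n)) 1 H + SchwartzMap.seminorm ℂ (10 * (n + n)) 1 H)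
        ((osAdjoint F).appendTensor (translateMulti (sch.a k • siteToE (Pi.single (0 : Fin 4) (m k : ℤ))) F))) := by
    filter_upwards [hmL] with k hk
    obtain ⟨hTL, hTw, hML⟩ := rope_support_bounds (T := T) (sch.a_pos k) hk
    exact norm_osCorr_sub_latticeConn_le r (sch.a_pos k) h12.1 hTL F hFp hFo hFT hTw hML (h19 k)
  -- (b) its right-hand side tends to zero
  have hε : Tendsto (fun k => 6 ^ n * 6 ^ n * (2 * sch.a k * K ^ (n + n) *
        (fun H : 𝓢((Fin (n + n) → E4), ℂ) => SchwartzMap.seminorm ℂ 0 (4 * (n + n) + 1) H +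
          SchwartzMap.seminorm ℂ (6 * (n + n)) (4 * (n + n) + 1) H + SchwartzMap.seminorm ℂ 0 1 H +
          SchwartzMap.seminorm ℂ (6 * (n + n)) 1 H + SchwartzMap.seminorm ℂ (10 * (n + n)) 1 H)
        ((osAdjoint F).appendTensor (translateMulti (sch.a k • siteToE (Pi.single (0 : Fin 4) (m k : ℤ))) F)))) atTop (𝓝 0) := by
    have h := ((sch.tendsto_a.const_mul 2).mul_const (K ^ (n + n))).mul
      (((continuous_seminorm_budget (n + n) (4 * (n + n) + 1) (6 * (n + n)) 1 (10 * (n + n))).tendsto _).comp hHk)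
    rw [mul_zero, zero_mul, zero_mul] at h
    simpa using h.const_mul ((6 : ℝ) ^ n * 6 ^ n)
  have hdiff := squeeze_zero_norm' hnear hε
  -- (c) the lattice OS forms of the moving witnesses converge
  have hZ : Tendsto (fun k => latticeDist r.ρ (sch.β k) (sch.L k) (sch.a k) r.curvature.F
      (wilsonTorusMean r.ρ (sch.β k) (sch.L k) r.curvature.F) (n + n)
        ((osAdjoint F).appendTensor (translateMulti (sch.a k • siteToE (Pi.single (0 : Fin 4) (m k : ℤ))) F))) atTop
      (𝓝 (S₁ (n + n) ((osAdjoint F).appendTensor (translateMulti (EuclideanSpace.single 0 t) F)))) := by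
    have hZ1 := h11 (n + n) (by omega) _ hHoff
    -- equicontinuity on `⁰𝒮` from the a-uniform bound of the plane strings
    have hbd : ∀ (k : ℕ) (H : 𝓢((Fin (n + n) → E4), ℂ)), IsOffDiagonal H →
        ‖latticeDist r.ρ (sch.β k) (sch.L k) (sch.a k) r.curvature.F (wilsonTorusMean r.ρ (sch.β k) (sch.L k) r.curvature.F) (n + n) H‖ ≤
          6 ^ (n + n) * (K ^ (n + n) * (SchwartzMap.seminorm ℂ 0 (4 * (n + n)) H +
            SchwartzMap.seminorm ℂ (6 * (n + n)) (4 * (n + n)) H + SchwartzMap.seminorm ℂ 0 0 H +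
            SchwartzMap.seminorm ℂ (6 * (n + n)) 0 H + SchwartzMap.seminorm ℂ (10 * (n + n)) 0 H)) := by
      intro k H hH
      have hq := fun (q : Fin (n + n) → Fin 4 × Fin 4) hq => h18 k (n + n) (by omega) q ((mem_planeStrings_iff q).1 hq) H hH
        (fun x l => sch.a k • siteToE (x l)) (fun x l => by rw [sub_self, norm_zero]; exact mul_nonneg (by norm_num) (sch.a_pos k).le)
      rw [latticeDist_dens_eq_sum_latticeDistStr]
      simp_rw [latticeDistStr_apply]
      refine (norm_sum_le _ _).trans ((Finset.sum_le_sum hq).trans_eq ?_)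
      rw [Finset.sum_const, Fintype.card_piFinset, Finset.prod_const, card_planes, Finset.card_univ, Fintype.card_fin,
        nsmul_eq_mul]
      push_cast; ring
    have h0 := ((continuous_seminorm_budget (n + n) (4 * (n + n)) (6 * (n + n)) 0 (10 * (n + n))).tendsto _).comp
      (hHk.sub_const ((osAdjoint F).appendTensor (translateMulti (EuclideanSpace.single 0 t) F)))
    rw [sub_self] at h0
    have hZ2 : Tendsto (fun k => latticeDist r.ρ (sch.β k) (sch.L k) (sch.a k) r.curvature.F
        (wilsonTorusMean r.ρ (sch.β k) (sch.L k) r.curvature.F) (n + n)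
          ((osAdjoint F).appendTensor (translateMulti (sch.a k • siteToE (Pi.single (0 : Fin 4) (m k : ℤ))) F)) -
        latticeDist r.ρ (sch.β k) (sch.L k) (sch.a k) r.curvature.F (wilsonTorusMean r.ρ (sch.β k) (sch.L k) r.curvature.F) (n + n)
          ((osAdjoint F).appendTensor (translateMulti (EuclideanSpace.single 0 t) F))) atTop (𝓝 0) :=
      squeeze_zero_norm (fun k => (congrArg (‖·‖) (map_sub _ _ _)).symm.trans_le (hbd k _ ((hHkoff k).sub hHoff)))
        (by simpa using (h0.const_mul (K ^ (n + n))).const_mul ((6 : ℝ) ^ (n + n)))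
    simpa using hZ2.add hZ1
  -- (d) the product of the means
  have hprod : Tendsto (fun k => conj (latticeDist r.ρ (sch.β k) (sch.L k) (sch.a k) r.curvature.F
      (wilsonTorusMean r.ρ (sch.β k) (sch.L k) r.curvature.F) n F) *
        latticeDist r.ρ (sch.β k) (sch.L k) (sch.a k) r.curvature.F (wilsonTorusMean r.ρ (sch.β k) (sch.L k) r.curvature.F) n F)
      atTop (𝓝 (conj (S₁ n F) * S₁ n F)) := by
    rcases Nat.lt_or_ge n 2 with h2 | h2
    · obtain rfl : n = 1 := by omega
      simp_rw [latticeDist_one_apply, h10]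
      exact tendsto_const_nhds
    · have hc := h11 n h2 F hFo
      exact ((Complex.continuous_conj.tendsto _).comp hc).mul hc
  -- (e) assemble
  have key := hdiff.add (hZ.sub hprod)
  rw [zero_add] at key
  exact key.congr fun k => sub_add_cancel _ _

end Summit.QuantumFields.YangMills.Theorems.OSLegsAtWeakCouplingC

end
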